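import Mathlib.Topology.Algebra.Order.LiminfLimsup
import Literature.Analysis.FluidPDE.PassiveScalarEnergyProofs
import HarnessLib

/-!
# Energy inequality for the passive scalar, IV: the pointwise-in-time form
  (discharge of `lintegral_sq_add_le`)

Analysis/FluidPDE proof file for the named fact
`Literature.Analysis.FluidPDE.Torus.IsWeakScalarTransportOn.lintegral_sq_add_le` of
`FluidPDE/PassiveScalar`: for `κ > 0`, `θ₀ ∈ L²(T^d)`, `u ∈ L^∞((0,T) × T^d)` (space–time lift) and
*every* weak solution `θ ∈ L^∞(0,T; L²)` of `∂ₜθ + u·∇θ = κΔθ` on `T^d × [0,T)`, for a.e.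
`t ∈ (0,T)`,

  `‖θ(t)‖²_{L²} + 2κ ∫₀ᵗ ‖∇θ(s)‖²_{L²} ds ≤ ‖θ₀‖²_{L²}`

(`lintegral_sq_add_le_holds`), the gradient norm being the spectral `Torus.eScalarGradNormSq`
(Bonicatto–Ciampa–Crippa 2023, Thm. 3.3 with `p = ∞`, `q = 2` and its energy balance (3.4),
there even with equality; Drivas–Elgindi–Iyer–Jeong 2022, (1.2) (arXiv numbering), the formal
identity `½‖θ(t)‖² = ½‖θ₀‖² - κ∫₀ᵗ‖∇θ‖²`; Evans 2010, §7.1.2 Thm. 2, the parabolic energy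
estimate). It refines the integrated form `2κ ∫₀ᵀ ‖∇θ‖² ≤ ‖θ₀‖²` already discharged in
`PassiveScalarEnergyProofs` (`energy_ineq_holds`) by keeping the slice term.

Proof. Exactly the mollification argument of `energy_ineq_holds` (files
`PassiveScalarEnergySlice`, `PassiveScalarEnergyMollified`, `PassiveScalarEnergyProofs`): with
`k_ε = kernel ε`, `εₙ = 1/(4(n+1))`, `Aₙ(t) = θ(t) ⋆ kₙ`, for a.e. `t` and every `n`,
`‖Aₙ(t)‖² + 2κ∫₀ᵗ‖∇Aₙ‖² ≤ ‖θ₀‖₂² + bₙ Yₙ^{1/2}` with `Yₙ = ∫₀ᵀ‖∇Aₙ‖₂²` and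
`bₙ = 4‖u‖_∞ (∫₀ᵀ ‖θ(s)⋆kₙ - θ(s)‖₂² ds)^{1/2} → 0` (the mollified energy identity with datum, the
slice inequality through weak incompressibility, Hölder in time, dominated convergence). The
Young absorption of `energy_ineq_holds` bounds `Yₙ` uniformly, so the error `cₙ = bₙ Yₙ^{1/2}`
tends to `0` *uniformly in `t`*. At a good time `t`: `‖Aₙ(t)‖₂² → ‖θ(t)‖₂²`
(`θ(t) ⋆ kₙ → θ(t)` in `L²`, `TorusConvolution.tendsto_eLpNorm_convolution_sub_self`),
`2κ∫₀ᵗ‖∇θ‖² ≤ liminfₙ 2κ∫₀ᵗ‖∇Aₙ‖²` (lower semicontinuity of the spectral gradient norm and Fatou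
in time), and the elementary `ℝ≥0∞` limit lemma `add_le_of_forall_add_le_add_of_tendsto` closes
the argument.

## Mathlib / tree search

Mathlib (this pin): `ENNReal.liminf_add_of_right_tendsto_zero`, `liminf_const_add`,
`ENNReal.Tendsto.sub`, `eLpNorm_add_le`, `lintegral_liminf_le'`,
`tendsto_lintegral_of_dominated_convergence'`, `integral_Ioc_eq_integral_Ioo`; no parabolic energy
estimates (searched `energy` in `Analysis/PDE`: none). Tree: everything of files I–III; the
`L²`-continuity lemma `tendsto_integral_norm_sq_of_tendsto_eLpNorm_sub` of `NSHopfEnergy` is the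
real-valued analogue of `tendsto_lintegral_enorm_sq_of_tendsto_eLpNorm_sub` below (not imported:
Navier–Stokes Galerkin chain).

## References

* P. Bonicatto, G. Ciampa, G. Crippa, *Weak and parabolic solutions of advection–diffusion
  equations with rough velocity field*, J. Evol. Equ. 24 (2024), Paper No. 1
  (arXiv:2306.15529), Thm. 3.3, (3.1)–(3.4), Remark 3.4. Bib key `BonicattoCiampaCrippa2023`.
* T. D. Drivas, T. M. Elgindi, G. Iyer, I.-J. Jeong, *Anomalous dissipation in passive scalar
  transport*, Arch. Ration. Mech. Anal. 243 (2022), 1151–1180 (arXiv:1911.03271), (1.1)–(1.2).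
  Bib key `DrivasEtAl2022` (interim stub `DEIJ2022`).
* L. C. Evans, *Partial Differential Equations*, 2nd ed. (AMS 2010), §7.1.2 Thm. 2 (energy
  estimates). Bib key `Evans2010`.
-/

noncomputable section

open MeasureTheory TopologicalSpace Set Function Filter Topology Metric ContinuousLinearMap
  UnitAddTorus
open scoped ENNReal NNReal Convolution ContDiff InnerProductSpace

namespace Literature.Analysis.FluidPDE

/-! ## Two limit lemmas in `ℝ≥0∞` -/

/-- **Passing to the limit in an approximate inequality** (in `ℝ≥0∞`): if `uₙ → X < ∞`,
`Y ≤ liminfₙ vₙ`, `cₙ → 0` and `uₙ + vₙ ≤ a + cₙ` for every `n`, then `X + Y ≤ a`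
(`X + vₙ ≤ a + (cₙ + (X - uₙ))` with `cₙ + (X - uₙ) → 0`, then `liminf`). [folklore] -/
theorem add_le_of_forall_add_le_add_of_tendsto {u v c : ℕ → ℝ≥0∞} {X Y a : ℝ≥0∞} (hX : X ≠ ⊤)
    (hu : Tendsto u atTop (𝓝 X)) (hv : Y ≤ liminf v atTop) (hc : Tendsto c atTop (𝓝 0))
    (h : ∀ n, u n + v n ≤ a + c n) : X + Y ≤ a := by
  have hsub : Tendsto (fun n => X - u n) atTop (𝓝 0) := by
    have := ENNReal.Tendsto.sub (tendsto_const_nhds (x := X)) hu (Or.inl hX)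
    rwa [tsub_self] at this
  have he : Tendsto (fun n => c n + (X - u n)) atTop (𝓝 0) := by
    simpa using hc.add hsub
  have hle : ∀ n, X + v n ≤ a + (c n + (X - u n)) := fun n =>
    calc X + v n ≤ (X - u n + u n) + v n := by
          gcongr
          exact le_tsub_add
      _ = (u n + v n) + (X - u n) := by ring
      _ ≤ (a + c n) + (X - u n) := add_le_add (h n) le_rfl
      _ = a + (c n + (X - u n)) := by ring
  have h1 : liminf (fun n => X + v n) atTop ≤ liminf (fun n => a + (c n + (X - u n))) atTop :=
    liminf_le_liminf (Eventually.of_forall hle)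
  have h2 : liminf (fun n => a + (c n + (X - u n))) atTop = a := by
    have := ENNReal.liminf_add_of_right_tendsto_zero he (fun _ => a)
    rw [liminf_const] at this
    exact this
  have h3 : liminf (fun n => X + v n) atTop = X + liminf v atTop :=
    liminf_const_add atTop v X (by isBoundedDefault) (by isBoundedDefault)
  calc X + Y ≤ X + liminf v atTop := by gcongr
    _ = liminf (fun n => X + v n) atTop := h3.symm
    _ ≤ liminf (fun n => a + (c n + (X - u n))) atTop := h1
    _ = a := h2

/-- **Strong `L²` convergence gives convergence of `∫⁻ ‖·‖ₑ²`**: if `‖fₙ - g‖_{L²} → 0` with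
`g ∈ L²`, then `∫⁻ ‖fₙ‖ₑ² → ∫⁻ ‖g‖ₑ²` (the triangle inequality squeezes `‖fₙ‖_{L²} → ‖g‖_{L²}`,
and `x ↦ x²` is continuous on `ℝ≥0∞`). [folklore] -/
theorem tendsto_lintegral_enorm_sq_of_tendsto_eLpNorm_sub {α : Type*} [MeasurableSpace α]
    {μ : Measure α} {f : ℕ → α → ℝ} {g : α → ℝ} (hf : ∀ n, AEStronglyMeasurable (f n) μ)
    (hg : MemLp g 2 μ) (h : Tendsto (fun n => eLpNorm (f n - g) 2 μ) atTop (𝓝 0)) :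
    Tendsto (fun n => ∫⁻ x, ‖f n x‖ₑ ^ 2 ∂μ) atTop (𝓝 (∫⁻ x, ‖g x‖ₑ ^ 2 ∂μ)) := by
  have hgt : eLpNorm g 2 μ ≠ ⊤ := hg.eLpNorm_ne_top
  have hup : ∀ n, eLpNorm (f n) 2 μ ≤ eLpNorm g 2 μ + eLpNorm (f n - g) 2 μ := fun n => by
    have e : g + (f n - g) = f n := by
      funext x
      simp
    calc eLpNorm (f n) 2 μ = eLpNorm (g + (f n - g)) 2 μ := by rw [e]
      _ ≤ eLpNorm g 2 μ + eLpNorm (f n - g) 2 μ := eLpNorm_add_le hg.1 ((hf n).sub hg.1) one_le_two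
  have hlow : ∀ n, eLpNorm g 2 μ - eLpNorm (f n - g) 2 μ ≤ eLpNorm (f n) 2 μ := fun n => by
    refine tsub_le_iff_right.2 ?_
    have e : f n + (g - f n) = g := by
      funext x
      simp
    calc eLpNorm g 2 μ = eLpNorm (f n + (g - f n)) 2 μ := by rw [e]
      _ ≤ eLpNorm (f n) 2 μ + eLpNorm (g - f n) 2 μ := eLpNorm_add_le (hf n) (hg.1.sub (hf n)) one_le_two
      _ = eLpNorm (f n) 2 μ + eLpNorm (f n - g) 2 μ := by rw [eLpNorm_sub_comm]
  have hnorm : Tendsto (fun n => eLpNorm (f n) 2 μ) atTop (𝓝 (eLpNorm g 2 μ)) := by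
    refine tendsto_of_tendsto_of_tendsto_of_le_of_le ?_ ?_ hlow hup
    · have := ENNReal.Tendsto.sub (tendsto_const_nhds (x := eLpNorm g 2 μ)) h (Or.inl hgt)
      rwa [tsub_zero] at this
    · have := (tendsto_const_nhds (x := eLpNorm g 2 μ)).add h
      rwa [add_zero] at this
  have h2 := ((ENNReal.continuous_pow 2).tendsto _).comp hnorm
  simp only [Function.comp_def, PassiveScalarProofs.eLpNorm_two_pow_two] at h2
  exact h2

namespace Torus

variable {d : Type*} [Fintype d]

namespace IsWeakScalarTransportOn

/-! ## Discharge of `lintegral_sq_add_le` -/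

/-- **Discharge of `Torus.IsWeakScalarTransportOn.lintegral_sq_add_le`** — the pointwise-in-time
energy inequality for weak solutions of the passive scalar equation with bounded drift: for
`κ > 0`, `θ₀ ∈ L²(T^d)`, `u ∈ L^∞((0,T) × T^d)` and every weak solution `θ ∈ L^∞(0,T; L²)` on
`[0,T)`, for a.e. `t ∈ (0,T)`,
`‖θ(t)‖²_{L²} + 2κ ∫₀ᵗ ‖∇θ(s)‖²_{L²} ds ≤ ‖θ₀‖²_{L²}` (Bonicatto–Ciampa–Crippa 2023, Thm. 3.3 with
`p = ∞`, `q = 2`: every such distributional solution is parabolic and satisfies the energy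
balance (3.4), in fact with equality (Remark 3.4); Drivas–Elgindi–Iyer–Jeong 2022, (1.2);
Evans 2010, §7.1.2 Thm. 2). Proof: mollify in space, `Aₙ = θ ⋆ kₙ`; the a.e.-in-time energy
identity `‖Aₙ(t)‖² = ‖θ₀ ⋆ kₙ‖² + 2∫₀ᵗ∫ Aₙ Gₙ` (`PassiveScalarEnergyMollified`) and the slice
inequality `∫ Aₙ Gₙ + κ‖∇Aₙ‖² ≤ 2‖u‖_∞ ‖θ ⋆ kₙ - θ‖₂ ‖∇Aₙ‖₂` (`PassiveScalarEnergySlice`) give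
`‖Aₙ(t)‖² + 2κ ∫₀ᵗ‖∇Aₙ‖² ≤ ‖θ₀‖₂² + bₙ √Yₙ`, `Yₙ = ∫₀ᵀ‖∇Aₙ‖₂²`, `bₙ → 0`; the Young absorption
of `energy_ineq_holds` bounds `Yₙ`, so the error tends to `0` uniformly in `t`; finally
`‖Aₙ(t)‖₂ → ‖θ(t)‖₂` and `∫₀ᵗ ‖∇θ‖² ≤ liminf ∫₀ᵗ ‖∇Aₙ‖²` (lower semicontinuity of the spectral
gradient norm, Fatou). [cite: BonicattoCiampaCrippa2023, Thm. 3.3] -/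
theorem lintegral_sq_add_le_holds : IsWeakScalarTransportOn.lintegral_sq_add_le (d := d) := by
  intro T κ hκ u θ₀ θ h hθ₀ hu
  -- trivial case `T ≤ 0`
  rcases le_or_gt T 0 with hT | hT
  · rw [Ioo_eq_empty_of_le hT, Measure.restrict_empty, ae_zero]
    exact eventually_bot
  set μT : Measure ℝ := (volume : Measure ℝ).restrict (Ioo 0 T) with hμT
  haveI : IsFiniteMeasure μT := by rw [hμT]; infer_instance
  -- the velocity bound
  obtain ⟨Cv, hCv0, hCv⟩ := ae_ae_norm_le_of_memLp_top_stLift hu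
  -- radii and kernels
  obtain ⟨hε, hε', hε0⟩ := molRadius_spec
  set ε : ℕ → ℝ := fun n => 1 / (4 * ((n : ℝ) + 1)) with hε_def
  have hkS : ∀ n, FunctionSpaces.Torus.IsSmooth (FunctionSpaces.Torus.kernel (d := d) (ε n)) :=
    fun n => FunctionSpaces.Torus.isSmooth_kernel (hε n) (hε' n)
  have hk1 : ∀ n, ∫⁻ y, ‖FunctionSpaces.Torus.kernel (d := d) (ε n) y‖ₑ = 1 :=
    fun n => FunctionSpaces.Torus.lintegral_enorm_kernel (hε n) (hε' n)
  -- `L²` and `L¹` bounds on the slices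
  obtain ⟨C₁, hC₁⟩ := h.exists_eLpNorm_le
  have hθ₀i : Integrable θ₀ volume := hθ₀.integrable one_le_two
  have hgood : ∀ᵐ s ∂μT, Integrable (θ s) volume ∧ AEStronglyMeasurable (u s) volume ∧
      (∀ᵐ y ∂volume, ‖u s y‖ ≤ Cv) ∧ FunctionSpaces.Torus.IsWeaklyDivFree (u s) ∧
      MemLp (θ s) 2 volume ∧ eLpNorm (θ s) 2 volume ≤ C₁ := by
    filter_upwards [h.ae_slice_integrable₁, hCv, h.ae_isWeaklyDivFree, h.ae_memLp_two, hC₁]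
      with s h1 h2 h3 h4 h5
    exact ⟨h1.1, h1.2.1, h2, h3, h4, h5⟩
  -- the mollified quantities
  set E : ℕ → ℝ → ℝ≥0∞ := fun n s =>
    eLpNorm (θ s ⋆ FunctionSpaces.Torus.kernel (ε n) - θ s) 2 volume with hE_def
  set N : ℕ → ℝ → ℝ≥0∞ := fun n s =>
    eLpNorm (fun x => ‖(θ s ⋆ FunctionSpaces.Torus.gradient (FunctionSpaces.Torus.kernel (ε n))) x‖)
      2 volume with hN_def
  set g : ℕ → ℝ → ℝ := fun n s =>
    ∫ x, ‖(θ s ⋆ FunctionSpaces.Torus.gradient (FunctionSpaces.Torus.kernel (ε n))) x‖ ^ 2 with hg_def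
  set Φ : ℕ → ℝ → ℝ := fun n s => ∫ x, (θ s ⋆ FunctionSpaces.Torus.kernel (ε n)) x * ∫ y, θ s y *
    (-⟪u s y, FunctionSpaces.Torus.gradient (FunctionSpaces.Torus.kernel (ε n)) (x - y)⟫_ℝ +
      κ * FunctionSpaces.Torus.laplacian (FunctionSpaces.Torus.kernel (ε n)) (x - y)) with hΦ_def
  have hEm : ∀ n, AEMeasurable (E n) μT := fun n =>
    h.aemeasurable_eLpNorm_conv_sub (hkS n).continuous
  have hNm : ∀ n, AEMeasurable (N n) μT := fun n =>
    h.aemeasurable_eLpNorm_norm_conv_gradient (hkS n)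
  have hgm : ∀ n, AEStronglyMeasurable (g n) μT := fun n =>
    h.aestronglyMeasurable_integral_norm_sq_conv_gradient (hkS n)
  have hg0 : ∀ n s, 0 ≤ g n s := fun n s => integral_nonneg fun x => sq_nonneg _
  -- the gradient of a mollified slice, and its spectral norm, at good times
  have hgradN : ∀ n, ∀ᵐ s ∂μT,
      eScalarGradNormSq (θ s ⋆ FunctionSpaces.Torus.kernel (ε n)) = ENNReal.ofReal (g n s) := by
    intro n
    filter_upwards [hgood] with s hs
    have hA : FunctionSpaces.Torus.IsSmooth (θ s ⋆ FunctionSpaces.Torus.kernel (ε n)) :=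
      FunctionSpaces.Torus.isSmooth_convolution hs.1 (hkS n)
    have hgrad : ∀ x, FunctionSpaces.Torus.gradient (θ s ⋆ FunctionSpaces.Torus.kernel (ε n)) x =
        (θ s ⋆ FunctionSpaces.Torus.gradient (FunctionSpaces.Torus.kernel (ε n))) x :=
      fun x => FunctionSpaces.Torus.gradient_convolution hs.1 (hkS n) x
    rw [eScalarGradNormSq_eq_ofReal_integral hA]
    simp only [hgrad, hg_def]
  -- `E n s ≤ 2 C₁` a.e., `E n s → 0` a.e., hence `∫ E² → 0`
  have hEle : ∀ n, ∀ᵐ s ∂μT, E n s ≤ 2 * C₁ := by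
    intro n
    filter_upwards [hgood] with s hs
    have hAm : AEStronglyMeasurable (θ s ⋆ FunctionSpaces.Torus.kernel (ε n)) volume :=
      (FunctionSpaces.Torus.continuous_convolution hs.1 (hkS n).continuous).aestronglyMeasurable
    calc E n s ≤ eLpNorm (θ s ⋆ FunctionSpaces.Torus.kernel (ε n)) 2 volume + eLpNorm (θ s) 2 volume :=
          eLpNorm_sub_le hAm hs.2.2.2.2.1.1 one_le_two
      _ ≤ (∫⁻ y, ‖FunctionSpaces.Torus.kernel (ε n) y‖ₑ) * eLpNorm (θ s) 2 volume +
            eLpNorm (θ s) 2 volume := by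
          gcongr
          exact FunctionSpaces.Torus.eLpNorm_convolution_le hs.1.aestronglyMeasurable
            (hkS n).continuous.aestronglyMeasurable one_le_two
      _ ≤ 2 * C₁ := by
          rw [hk1 n, one_mul, two_mul]
          exact add_le_add hs.2.2.2.2.2 hs.2.2.2.2.2
  have hE0 : ∀ᵐ s ∂μT, Tendsto (fun n => E n s) atTop (𝓝 0) := by
    filter_upwards [hgood] with s hs
    exact FunctionSpaces.Torus.tendsto_eLpNorm_convolution_sub_self hs.2.2.2.2.1
      (fun n y => FunctionSpaces.Torus.kernel_nonneg (hε n).le y)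
      (fun n => FunctionSpaces.Torus.integral_kernel (hε n) (hε' n))
      (fun n => FunctionSpaces.Torus.support_kernel_subset (hε n))
      (fun n => FunctionSpaces.Torus.continuous_kernel (hε n) (hε' n)) hε0
  have hE2 : Tendsto (fun n => ∫⁻ s, E n s ^ 2 ∂μT) atTop (𝓝 0) := by
    have hb : ∫⁻ _ : ℝ, ((2 : ℝ≥0∞) * C₁) ^ 2 ∂μT ≠ ⊤ := by
      rw [lintegral_const]
      exact ENNReal.mul_ne_top (ENNReal.pow_ne_top (ENNReal.mul_ne_top ENNReal.ofNat_ne_top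
        ENNReal.coe_ne_top)) (measure_ne_top _ _)
    have hlim : ∀ᵐ s ∂μT, Tendsto (fun n => E n s ^ 2) atTop (𝓝 ((fun _ => (0 : ℝ≥0∞)) s)) := by
      filter_upwards [hE0] with s hs
      have := ((ENNReal.continuous_pow 2).tendsto 0).comp hs
      rw [zero_pow two_ne_zero] at this
      exact this
    have := tendsto_lintegral_of_dominated_convergence' (fun _ => ((2 : ℝ≥0∞) * C₁) ^ 2)
      (fun n => (hEm n).pow_const 2) (fun n => (hEle n).mono fun s hs => by
        dsimp only
        gcongr) hb hlim
    simpa using this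
  -- `g n` is bounded a.e. and integrable on `(0,T)`; `N n s ^ 2 = ofReal (g n s)` a.e.
  have hN2 : ∀ n, ∀ᵐ s ∂μT, N n s ^ 2 = ENNReal.ofReal (g n s) := by
    intro n
    filter_upwards [hgood] with s hs
    have hc : Continuous fun x =>
        ‖(θ s ⋆ FunctionSpaces.Torus.gradient (FunctionSpaces.Torus.kernel (ε n))) x‖ :=
      (FunctionSpaces.Torus.continuous_convolution hs.1 (hkS n).gradient.continuous).norm
    simp only [hN_def, hg_def]
    rw [PassiveScalarProofs.eLpNorm_two_pow_two, lintegral_enorm_sq_eq_ofReal_integral_sq hc]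
  have hgb : ∀ n, ∃ K : ℝ, ∀ᵐ s ∂μT, g n s ≤ K := by
    intro n
    obtain ⟨Ck, hCk⟩ :=
      FunctionSpaces.Torus.exists_forall_norm_le_of_continuous (hkS n).gradient.continuous
    refine ⟨(Ck * C₁) ^ 2, ?_⟩
    filter_upwards [hgood] with s hs
    have hpt : ∀ x,
        ‖(θ s ⋆ FunctionSpaces.Torus.gradient (FunctionSpaces.Torus.kernel (ε n))) x‖ ≤ Ck * C₁ :=
      fun x => by
      refine (FunctionSpaces.Torus.norm_convolution_le hs.1 hCk x).trans
        (mul_le_mul_of_nonneg_left ?_ ((norm_nonneg _).trans (hCk 0)))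
      have e : ∫ y, ‖θ s y‖ = ∫ y, |θ s y| := integral_congr_ae (Eventually.of_forall fun y => by
        simp [Real.norm_eq_abs])
      rw [e]
      exact integral_abs_le_of_eLpNorm_le hs.2.2.2.2.1 hs.2.2.2.2.2
    have hc : Continuous fun x =>
        ‖(θ s ⋆ FunctionSpaces.Torus.gradient (FunctionSpaces.Torus.kernel (ε n))) x‖ :=
      (FunctionSpaces.Torus.continuous_convolution hs.1 (hkS n).gradient.continuous).norm
    calc g n s ≤ ∫ _ : UnitAddTorus d, (Ck * C₁) ^ 2 := by
          refine integral_mono (hc.pow 2).integrable_unitAddTorus (integrable_const _) fun x => ?_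
          dsimp only
          exact pow_le_pow_left₀ (norm_nonneg _) (hpt x) 2
      _ = (Ck * C₁) ^ 2 := by simp
  have hgi : ∀ n, Integrable (g n) μT := by
    intro n
    obtain ⟨K, hK⟩ := hgb n
    refine Integrable.mono' (integrable_const (max K 0)) (hgm n) ?_
    filter_upwards [hK] with s hs
    rw [Real.norm_eq_abs, abs_of_nonneg (hg0 n s)]
    exact hs.trans (le_max_left _ _)
  have hY : ∀ n, ∫⁻ s, N n s ^ 2 ∂μT = ENNReal.ofReal (∫ s, g n s ∂μT) := by
    intro n
    rw [lintegral_congr_ae (hN2 n), ← ofReal_integral_eq_lintegral_ofReal (hgi n)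
      (Eventually.of_forall (hg0 n))]
  -- the datum term
  set a : ℝ≥0∞ := ∫⁻ x, ‖θ₀ x‖ₑ ^ 2 with ha_def
  have hat : a ≠ ⊤ := by
    rw [ha_def, ← PassiveScalarProofs.eLpNorm_two_pow_two]
    exact ENNReal.pow_ne_top hθ₀.eLpNorm_ne_top
  have ha0 : ∀ n, ENNReal.ofReal (∫ x, (θ₀ ⋆ FunctionSpaces.Torus.kernel (ε n)) x ^ 2) ≤ a := by
    intro n
    have hc : Continuous (θ₀ ⋆ FunctionSpaces.Torus.kernel (ε n)) :=
      FunctionSpaces.Torus.continuous_convolution hθ₀i (hkS n).continuous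
    rw [← lintegral_enorm_sq_eq_ofReal_integral_sq hc, ← PassiveScalarProofs.eLpNorm_two_pow_two, ha_def,
      ← PassiveScalarProofs.eLpNorm_two_pow_two]
    gcongr
    calc eLpNorm (θ₀ ⋆ FunctionSpaces.Torus.kernel (ε n)) 2 volume
        ≤ (∫⁻ y, ‖FunctionSpaces.Torus.kernel (ε n) y‖ₑ) * eLpNorm θ₀ 2 volume :=
          FunctionSpaces.Torus.eLpNorm_convolution_le hθ₀.1 (hkS n).continuous.aestronglyMeasurable
            one_le_two
      _ = eLpNorm θ₀ 2 volume := by rw [hk1 n, one_mul]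
  -- the vanishing coefficient `b n = 4 ‖u‖_∞ (∫ E²)^{1/2}`
  set b : ℕ → ℝ≥0∞ := fun n => 4 * ENNReal.ofReal Cv * (∫⁻ s, E n s ^ 2 ∂μT) ^ (1 / 2 : ℝ)
    with hb_def
  have hbt : ∀ n, b n ≠ ⊤ := by
    intro n
    refine ENNReal.mul_ne_top (ENNReal.mul_ne_top (by norm_num) ENNReal.ofReal_ne_top)
      (ENNReal.rpow_ne_top_of_nonneg (by norm_num) ?_)
    have hle : ∫⁻ s, E n s ^ 2 ∂μT ≤ ∫⁻ _ : ℝ, ((2 : ℝ≥0∞) * C₁) ^ 2 ∂μT :=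
      lintegral_mono_ae ((hEle n).mono fun s hs => pow_le_pow_left' hs 2)
    refine ne_top_of_le_ne_top ?_ hle
    rw [lintegral_const]
    exact ENNReal.mul_ne_top (ENNReal.pow_ne_top (ENNReal.mul_ne_top ENNReal.ofNat_ne_top
      ENNReal.coe_ne_top)) (measure_ne_top _ _)
  have hb0 : Tendsto b atTop (𝓝 0) := by
    have h1 := (hE2.ennrpow_const (1 / 2 : ℝ))
    rw [ENNReal.zero_rpow_of_pos (by norm_num)] at h1
    have h2 := ENNReal.Tendsto.const_mul h1 (Or.inr (ENNReal.mul_ne_top (by norm_num)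
      ENNReal.ofReal_ne_top) : (0 : ℝ≥0∞) ≠ 0 ∨ 4 * ENNReal.ofReal Cv ≠ ⊤)
    rw [mul_zero] at h2
    exact h2
  -- **the core estimate**, for a.e. `t`, keeping the slice term:
  -- `ofReal ‖Aₙ(t)‖² + ofReal (2κ ∫_{(0,t]} gₙ) ≤ a + bₙ Yₙ^{1/2}`
  have hcore : ∀ n, ∀ᵐ t ∂μT,
      ENNReal.ofReal (∫ x, ((θ t) ⋆ FunctionSpaces.Torus.kernel (ε n)) x ^ 2) +
        ENNReal.ofReal (2 * κ * ∫ s in Ioc 0 t, g n s) ≤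
      a + b n * (ENNReal.ofReal (∫ s, g n s ∂μT)) ^ (1 / 2 : ℝ) := by
    intro n
    filter_upwards [h.ae_integral_sq_molInt_eq hθ₀i (hkS n), ae_restrict_mem measurableSet_Ioo]
      with t hid htT
    have hsub : Ioc 0 t ⊆ Ioo 0 T := Ioc_subset_Ioo_right htT.2
    have hΦi : IntegrableOn (Φ n) (Ioc 0 t) volume :=
      (h.integrableOn_integral_conv_mul_flux (hkS n)).mono_set hsub
    have hgi' : IntegrableOn (g n) (Ioc 0 t) volume :=
      (show IntegrableOn (g n) (Ioo 0 T) volume from hgi n).mono_set hsub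
    -- real form
    have hreal : (∫ x, ((θ t) ⋆ FunctionSpaces.Torus.kernel (ε n)) x ^ 2) +
        2 * κ * ∫ s in Ioc 0 t, g n s =
        (∫ x, (θ₀ ⋆ FunctionSpaces.Torus.kernel (ε n)) x ^ 2) +
          2 * ∫ s in Ioc 0 t, (Φ n s + κ * g n s) := by
      have hid' : ∫ x, ((θ t) ⋆ FunctionSpaces.Torus.kernel (ε n)) x ^ 2 =
          (∫ x, (θ₀ ⋆ FunctionSpaces.Torus.kernel (ε n)) x ^ 2) + 2 * ∫ s in Ioc 0 t, Φ n s := hid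
      have e : ∫ s in Ioc 0 t, (Φ n s + κ * g n s) =
          (∫ s in Ioc 0 t, Φ n s) + κ * ∫ s in Ioc 0 t, g n s := by
        rw [integral_add hΦi (hgi'.const_mul κ), MeasureTheory.integral_const_mul]
      rw [hid', e]
      ring
    -- pass to `ℝ≥0∞`
    have hpos₁ : 0 ≤ ∫ x, ((θ t) ⋆ FunctionSpaces.Torus.kernel (ε n)) x ^ 2 :=
      integral_nonneg fun x => sq_nonneg _
    have hpos₂ : 0 ≤ 2 * κ * ∫ s in Ioc 0 t, g n s :=
      mul_nonneg (by positivity) (setIntegral_nonneg measurableSet_Ioc fun s _ => hg0 n s)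
    have h1 : ENNReal.ofReal (∫ x, ((θ t) ⋆ FunctionSpaces.Torus.kernel (ε n)) x ^ 2) +
        ENNReal.ofReal (2 * κ * ∫ s in Ioc 0 t, g n s) ≤
        a + 2 * ∫⁻ s in Ioc 0 t, ENNReal.ofReal (Φ n s + κ * g n s) := by
      rw [← ENNReal.ofReal_add hpos₁ hpos₂, hreal]
      refine ENNReal.ofReal_add_le.trans ?_
      refine add_le_add (ha0 n) ?_
      rw [ENNReal.ofReal_mul zero_le_two, ENNReal.ofReal_ofNat]
      gcongr
      exact ofReal_integral_le_lintegral_ofReal _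
    -- the slice inequality under the integral
    have h2 : ∫⁻ s in Ioc 0 t, ENNReal.ofReal (Φ n s + κ * g n s) ≤
        ∫⁻ s in Ioc 0 t, ENNReal.ofReal Cv * (2 * E n s) * N n s := by
      refine lintegral_mono_ae (ae_restrict_of_ae_restrict_of_subset hsub ?_)
      filter_upwards [hgood] with s hs
      have hslice := ofReal_integral_conv_mul_flux_add_le (δ := θ s) (ε := ε n) hs.1 hs.2.1
        hs.2.2.1 hs.2.2.2.1 (hε n) (hε' n) κ
      have hgrad : ∀ x, FunctionSpaces.Torus.gradient (θ s ⋆ FunctionSpaces.Torus.kernel (ε n)) x =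
          (θ s ⋆ FunctionSpaces.Torus.gradient (FunctionSpaces.Torus.kernel (ε n))) x :=
        fun x => FunctionSpaces.Torus.gradient_convolution hs.1 (hkS n) x
      simp only [hgrad] at hslice
      exact hslice
    -- Hölder in time
    have h3 : ∫⁻ s in Ioc 0 t, ENNReal.ofReal Cv * (2 * E n s) * N n s ≤
        2 * ENNReal.ofReal Cv * ((∫⁻ s, E n s ^ 2 ∂μT) ^ (1 / 2 : ℝ) *
          (∫⁻ s, N n s ^ 2 ∂μT) ^ (1 / 2 : ℝ)) := by
      have hH : ∫⁻ s, E n s * N n s ∂μT ≤ (∫⁻ s, E n s ^ 2 ∂μT) ^ (1 / 2 : ℝ) *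
          (∫⁻ s, N n s ^ 2 ∂μT) ^ (1 / 2 : ℝ) := by
        have hH' := ENNReal.lintegral_mul_le_Lp_mul_Lq μT Real.HolderConjugate.two_two (hEm n) (hNm n)
        have e1 : ∫⁻ s, E n s ^ 2 ∂μT = ∫⁻ s, E n s ^ (2 : ℝ) ∂μT :=
          lintegral_congr fun s => by rw [ENNReal.rpow_two]
        have e2 : ∫⁻ s, N n s ^ 2 ∂μT = ∫⁻ s, N n s ^ (2 : ℝ) ∂μT :=
          lintegral_congr fun s => by rw [ENNReal.rpow_two]
        rw [e1, e2]
        exact hH'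
      calc ∫⁻ s in Ioc 0 t, ENNReal.ofReal Cv * (2 * E n s) * N n s
          ≤ ∫⁻ s in Ioo 0 T, ENNReal.ofReal Cv * (2 * E n s) * N n s := lintegral_mono_set hsub
        _ = 2 * ENNReal.ofReal Cv * ∫⁻ s, E n s * N n s ∂μT := by
            rw [hμT, ← lintegral_const_mul' _ _ (ENNReal.mul_ne_top ENNReal.ofNat_ne_top
              ENNReal.ofReal_ne_top)]
            refine lintegral_congr fun s => ?_
            ring
        _ ≤ 2 * ENNReal.ofReal Cv * ((∫⁻ s, E n s ^ 2 ∂μT) ^ (1 / 2 : ℝ) *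
              (∫⁻ s, N n s ^ 2 ∂μT) ^ (1 / 2 : ℝ)) := by
            gcongr
    calc ENNReal.ofReal (∫ x, ((θ t) ⋆ FunctionSpaces.Torus.kernel (ε n)) x ^ 2) +
          ENNReal.ofReal (2 * κ * ∫ s in Ioc 0 t, g n s)
        ≤ a + 2 * ∫⁻ s in Ioc 0 t, ENNReal.ofReal (Φ n s + κ * g n s) := h1
      _ ≤ a + 2 * (2 * ENNReal.ofReal Cv * ((∫⁻ s, E n s ^ 2 ∂μT) ^ (1 / 2 : ℝ) *
          (∫⁻ s, N n s ^ 2 ∂μT) ^ (1 / 2 : ℝ))) := by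
          gcongr
          exact h2.trans h3
      _ = a + b n * (ENNReal.ofReal (∫ s, g n s ∂μT)) ^ (1 / 2 : ℝ) := by
          rw [hY n, hb_def]
          ring
  -- **at `t = T`**, in real form: `2κ yₙ ≤ a + bₙ √yₙ` with `yₙ = ∫_{(0,T)} gₙ`
  set y : ℕ → ℝ := fun n => ∫ s, g n s ∂μT with hy_def
  have hy0 : ∀ n, 0 ≤ y n := fun n => integral_nonneg (hg0 n)
  have hyT : ∀ n, 2 * κ * y n ≤ a.toReal + (b n).toReal * Real.sqrt (y n) := by
    intro n
    set R : ℝ≥0∞ := a + b n * (ENNReal.ofReal (y n)) ^ (1 / 2 : ℝ) with hR_def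
    have hRt : R ≠ ⊤ := ENNReal.add_ne_top.2 ⟨hat, ENNReal.mul_ne_top (hbt n)
      (ENNReal.rpow_ne_top_of_nonneg (by norm_num) ENNReal.ofReal_ne_top)⟩
    have hR : R.toReal = a.toReal + (b n).toReal * Real.sqrt (y n) := by
      rw [hR_def, ENNReal.toReal_add hat (ENNReal.mul_ne_top (hbt n)
        (ENNReal.rpow_ne_top_of_nonneg (by norm_num) ENNReal.ofReal_ne_top)), ENNReal.toReal_mul,
        ENNReal.ofReal_rpow_of_nonneg (hy0 n) (by norm_num), ENNReal.toReal_ofReal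
          (Real.rpow_nonneg (hy0 n) _), Real.sqrt_eq_rpow]
    have hK : ∀ᵐ t ∂μT, ∫ s in Ioc 0 t, g n s ≤ R.toReal / (2 * κ) := by
      filter_upwards [hcore n] with t ht
      rw [le_div_iff₀ (by positivity), mul_comm]
      exact (ENNReal.ofReal_le_iff_le_toReal hRt).1 (le_add_self.trans ht)
    have := setIntegral_Ioo_le_of_ae_setIntegral_Ioc_le hT (hgi n) hK
    rw [le_div_iff₀ (by positivity)] at this
    rw [← hR]
    linarith
  -- hence `2κ yₙ ≤ a + δ` eventually, for every `δ > 0`: the `yₙ` are bounded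
  have hbR : Tendsto (fun n => (b n).toReal) atTop (𝓝 0) := by
    have := (ENNReal.tendsto_toReal ENNReal.zero_ne_top).comp hb0
    rw [ENNReal.toReal_zero] at this
    exact this
  have hev : ∀ δ : ℝ, 0 < δ → ∀ᶠ n in atTop, 2 * κ * y n ≤ a.toReal + δ := fun δ hδ =>
    eventually_le_add_of_le_add_mul_sqrt hκ ENNReal.toReal_nonneg hy0 hbR hyT hδ
  -- **the error term `cₙ = bₙ √Yₙ` tends to `0`** (uniformly in `t`)
  set c : ℕ → ℝ≥0∞ := fun n => b n * (ENNReal.ofReal (y n)) ^ (1 / 2 : ℝ) with hc_def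
  have hc0 : Tendsto c atTop (𝓝 0) := by
    set M : ℝ := (a.toReal + 1) / (2 * κ) with hM_def
    have hyM : ∀ᶠ n in atTop, y n ≤ M := by
      filter_upwards [hev 1 one_pos] with n hn
      rw [hM_def, le_div_iff₀ (by positivity)]
      linarith
    have hbM : Tendsto (fun n => b n * (ENNReal.ofReal M) ^ (1 / 2 : ℝ)) atTop (𝓝 0) := by
      have := ENNReal.Tendsto.mul_const hb0 (Or.inr (ENNReal.rpow_ne_top_of_nonneg (by norm_num)
        ENNReal.ofReal_ne_top) : (0 : ℝ≥0∞) ≠ 0 ∨ (ENNReal.ofReal M) ^ (1 / 2 : ℝ) ≠ ⊤)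
      rwa [zero_mul] at this
    refine tendsto_of_tendsto_of_tendsto_of_le_of_le' tendsto_const_nhds hbM
      (Eventually.of_forall fun n => zero_le) ?_
    filter_upwards [hyM] with n hn
    simp only [hc_def]
    gcongr
  -- **conclusion at a.e. `t`**
  have hall := ae_all_iff.2 hcore
  have h2κ : (2 : ℝ≥0∞) * ENNReal.ofReal κ = ENNReal.ofReal (2 * κ) := by
    rw [ENNReal.ofReal_mul zero_le_two, ENNReal.ofReal_ofNat]
  filter_upwards [hall, hgood, hE0, ae_restrict_mem measurableSet_Ioo] with t hct hgt hE0t htT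
  have hsubT : Ioo 0 t ⊆ Ioo 0 T := Ioo_subset_Ioo_right htT.2.le
  set μt : Measure ℝ := (volume : Measure ℝ).restrict (Ioo 0 t) with hμt
  have hle_t : μt ≤ μT := Measure.restrict_mono_set _ hsubT
  have hgood_t := ae_restrict_of_ae_restrict_of_subset hsubT hgood
  have hE0_t := ae_restrict_of_ae_restrict_of_subset hsubT hE0
  -- (1) the slice term converges: `‖θ(t) ⋆ kₙ‖₂² → ‖θ(t)‖₂²`
  have hX : ∫⁻ x, ‖θ t x‖ₑ ^ 2 ≠ ⊤ := by
    rw [← PassiveScalarProofs.eLpNorm_two_pow_two]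
    exact ENNReal.pow_ne_top hgt.2.2.2.2.1.eLpNorm_ne_top
  have hut : Tendsto (fun n => ENNReal.ofReal (∫ x, ((θ t) ⋆ FunctionSpaces.Torus.kernel (ε n)) x ^ 2))
      atTop (𝓝 (∫⁻ x, ‖θ t x‖ₑ ^ 2)) := by
    have hlim := tendsto_lintegral_enorm_sq_of_tendsto_eLpNorm_sub
      (fun n => (FunctionSpaces.Torus.continuous_convolution hgt.1 (hkS n).continuous).aestronglyMeasurable)
      hgt.2.2.2.2.1 hE0t
    refine hlim.congr fun n => ?_
    exact lintegral_enorm_sq_eq_ofReal_integral_sq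
      (FunctionSpaces.Torus.continuous_convolution hgt.1 (hkS n).continuous)
  -- (2) Fatou on `(0,t)`: `2κ ∫₀ᵗ ‖∇θ‖² ≤ liminfₙ ofReal (2κ ∫_{(0,t]} gₙ)`
  have hFatou : 2 * eScalarDissipation κ θ 0 t ≤
      liminf (fun n => ENNReal.ofReal (2 * κ * ∫ s in Ioc 0 t, g n s)) atTop := by
    have hAEm : ∀ n, AEMeasurable (fun s => ENNReal.ofReal (2 * κ) *
        eScalarGradNormSq (θ s ⋆ FunctionSpaces.Torus.kernel (ε n))) μt := by
      intro n
      refine (((hgm n).mono_measure hle_t).aemeasurable.ennreal_ofReal.const_mul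
        (ENNReal.ofReal (2 * κ))).congr ?_
      filter_upwards [ae_restrict_of_ae_restrict_of_subset hsubT (hgradN n)] with s hs
      rw [hs]
    have hint : ∀ n, ∫⁻ s, ENNReal.ofReal (2 * κ) *
        eScalarGradNormSq (θ s ⋆ FunctionSpaces.Torus.kernel (ε n)) ∂μt =
        ENNReal.ofReal (2 * κ * ∫ s in Ioc 0 t, g n s) := by
      intro n
      have hgi_t : Integrable (g n) μt := (hgi n).mono_measure hle_t
      rw [lintegral_const_mul' _ _ ENNReal.ofReal_ne_top,
        ENNReal.ofReal_mul (p := 2 * κ) (by positivity), integral_Ioc_eq_integral_Ioo]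
      congr 1
      rw [hμt, ofReal_integral_eq_lintegral_ofReal hgi_t (Eventually.of_forall (hg0 n))]
      refine lintegral_congr_ae ?_
      filter_upwards [ae_restrict_of_ae_restrict_of_subset hsubT (hgradN n)] with s hs
      rw [hs]
    calc 2 * eScalarDissipation κ θ 0 t
        = ∫⁻ s, ENNReal.ofReal (2 * κ) * eScalarGradNormSq (θ s) ∂μt := by
          rw [eScalarDissipation, ← mul_assoc, h2κ, hμt, lintegral_const_mul' _ _ ENNReal.ofReal_ne_top]
      _ ≤ ∫⁻ s, liminf (fun n => ENNReal.ofReal (2 * κ) *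
            eScalarGradNormSq (θ s ⋆ FunctionSpaces.Torus.kernel (ε n))) atTop ∂μt := by
          refine lintegral_mono_ae ?_
          filter_upwards [hgood_t, hE0_t] with s hs hs0
          exact mul_eScalarGradNormSq_le_liminf hs.1
            (fun n => (FunctionSpaces.Torus.isSmooth_convolution hs.1 (hkS n)).integrable) hs0
            ENNReal.ofReal_ne_top
      _ ≤ liminf (fun n => ∫⁻ s, ENNReal.ofReal (2 * κ) *
            eScalarGradNormSq (θ s ⋆ FunctionSpaces.Torus.kernel (ε n)) ∂μt) atTop :=
          lintegral_liminf_le' hAEm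
      _ = liminf (fun n => ENNReal.ofReal (2 * κ * ∫ s in Ioc 0 t, g n s)) atTop := by
          simp_rw [hint]
  -- (3) pass to the limit in the core estimate
  exact add_le_of_forall_add_le_add_of_tendsto hX hut hFatou hc0 hct

end IsWeakScalarTransportOn

end Torus

end Literature.Analysis.FluidPDE
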